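import Literature.NumberTheory.PAdicHodge.TateGradedFiltration
import Mathlib.GroupTheory.Index
import HarnessLib

/-!
# `Fil⁰`-coboundaries descend along subgroups of finite index (corestriction–restriction in characteristic `0`)

Topic `Literature/NumberTheory/PAdicHodge`; namespace `Literature.NumberTheory.GaloisRepresentations.PeriodRingData` (extends the tree
structure `PeriodRingData`). THEOREMS ONLY (no definition, no named fact, no instance, no `sorry`).

For a period-ring datum `𝔅` over `(Γ, P, E)` with `char E = 0`, a representation `ρ` of `Γ` on `V`, and a `1`-cocycle
`c : Γ → B ⊗ V` for the diagonal action (`c(στ) = c(σ) + σ·c(τ)`) with values in `Fil⁰(B ⊗ V)`: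

* §1 cocycle algebra — a cocycle vanishing on a subgroup `H` is constant on the left cosets `gH` (`apply_mul_eq_of_forall_mem`),
  `σ·c(τ) = c(στ) − c(σ)` (`tensorRep_apply_eq_sub`), change of coboundary (`sub_coboundary_cocycle`);
* §2 **`IsFilZeroCoboundary.of_subgroup`** — if `H ≤ Γ` has FINITE INDEX and `c|_H` is a `Fil⁰`-coboundary (`c(h) = h·b − b`, `b ∈ Fil⁰`),
  then `c` is a `Fil⁰`-coboundary on `Γ`: with `c' = c − ∂b` (vanishing on `H`) and the AVERAGE `y = Σ_{gH ∈ Γ/H} c'(g)` one has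
  `σ·y = y − [Γ:H]·c'(σ)` (reindex the cosets by `gH ↦ σgH`), so `c' = ∂(−y/[Γ:H])` — the cochain-level `cor ∘ res = [Γ:H]`
  on `H¹`, invertible in characteristic `0`; `Fil⁰(B ⊗ V)` is an `E`-submodule stable under `Γ`, so the integrating element stays in `Fil⁰`;
  and the group-homomorphism form `IsFilZeroCoboundary.of_range` (`ι : Γ' →* Γ` with finite-index range, the shape of
  `absGaloisRestrict F F'` for a finite extension `F'/F`).

Use (BSD route EdixhovenFibreFiveSeven, crux K★ `stmt-BirchSwinnertonDyer-22226`, hT₂ programme brick K1): the Kummer cocycle of a rational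
point dies in `H¹(F', B_dR⁺ ⊗ V_pE)` over the field `F' = F(ϖ)` of good reduction (`KummerFilZeroCoboundaryRamifiedOfWeil`); this file is the
group-theoretic half of the descent to `F` (the other half, `B_dR(F') = B_dR(F)`, is `BdRBaseChange`). BSD / K★ are not proved by any of this.

## References
* [NeukirchSchmidtWingberg2008] J. Neukirch, A. Schmidt, K. Wingberg, *Cohomology of Number Fields* (2008), (1.5.7)–(1.6.11)
  (`cor ∘ res = [G:H]`; uniquely divisible modules).
* [Kato1993LNM1553] K. Kato, LNM 1553 (1993), Ch. II §1.2.4 (`H¹(K, B_dR⁺ ⊗ V)`).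
* [BlochKato1990] S. Bloch, K. Kato (1990), Lemma 3.8.1.
-/

noncomputable section

open scoped TensorProduct

namespace Literature.NumberTheory.GaloisRepresentations.PeriodRingData

section Descent

-- Mathlib's own global value of `maxSynthPendingDepth` (instance problems on `𝔅.B ⊗[P] M`, see `PAdicHodgeProofs`).
set_option maxSynthPendingDepth 3

universe u v v' w w'

variable {Γ : Type u} [Group Γ] [TopologicalSpace Γ] {P : Type v} {E : Type v'} [Field P]
  [TopologicalSpace P] [Field E] [Algebra P E]
  {M : Type w'} [AddCommGroup M] [Module P M] [TopologicalSpace M]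
  (𝔅 : PeriodRingData.{u, v, v', w} Γ P E) (ρ : ContinuousRep Γ P M)

/-! ## §1 Cocycle algebra -/

/-- A `1`-cocycle vanishes at `1`. [cite: NeukirchSchmidtWingberg2008, (1.2.4)] -/
theorem apply_one_eq_zero_of_cocycle {c : Γ → 𝔅.B ⊗[P] M}
    (hc : ∀ σ τ, c (σ * τ) = c σ + 𝔅.tensorRep ρ σ (c τ)) : c 1 = 0 := by
  have h := hc 1 1
  rw [mul_one, map_one, Module.End.one_apply] at h
  exact (add_eq_left.1 h.symm)

/-- For a `1`-cocycle: `σ·c(τ) = c(στ) − c(σ)`. [cite: NeukirchSchmidtWingberg2008, (1.2.4)] -/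
theorem tensorRep_apply_eq_sub {c : Γ → 𝔅.B ⊗[P] M}
    (hc : ∀ σ τ, c (σ * τ) = c σ + 𝔅.tensorRep ρ σ (c τ)) (σ τ : Γ) :
    𝔅.tensorRep ρ σ (c τ) = c (σ * τ) - c σ := by
  rw [hc σ τ, add_sub_cancel_left]

/-- **A cocycle vanishing on a subgroup `H` is constant on the left cosets `gH`.** [cite: NeukirchSchmidtWingberg2008, (1.6.1)] -/
theorem apply_mul_eq_of_forall_mem {c : Γ → 𝔅.B ⊗[P] M}
    (hc : ∀ σ τ, c (σ * τ) = c σ + 𝔅.tensorRep ρ σ (c τ)) {H : Subgroup Γ} (h0 : ∀ h ∈ H, c h = 0)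
    (g : Γ) {h : Γ} (hh : h ∈ H) : c (g * h) = c g := by
  rw [hc g h, h0 h hh, map_zero, add_zero]

/-- **Change of coboundary**: `c − ∂b` is again a cocycle (`∂b = (σ ↦ σ·b − b)`). [cite: NeukirchSchmidtWingberg2008, (1.2.4)] -/
theorem sub_coboundary_cocycle {c : Γ → 𝔅.B ⊗[P] M}
    (hc : ∀ σ τ, c (σ * τ) = c σ + 𝔅.tensorRep ρ σ (c τ)) (b : 𝔅.B ⊗[P] M) (σ τ : Γ) :
    (c (σ * τ) - (𝔅.tensorRep ρ (σ * τ) b - b)) =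
      (c σ - (𝔅.tensorRep ρ σ b - b)) + 𝔅.tensorRep ρ σ (c τ - (𝔅.tensorRep ρ τ b - b)) := by
  rw [hc σ τ, map_sub, map_sub, map_mul, Module.End.mul_apply]
  abel

/-- Two representatives of the same left coset give the same value of an `H`-vanishing cocycle. [cite: NeukirchSchmidtWingberg2008, (1.6.1)] -/
theorem apply_eq_of_mk_eq {c : Γ → 𝔅.B ⊗[P] M}
    (hc : ∀ σ τ, c (σ * τ) = c σ + 𝔅.tensorRep ρ σ (c τ)) {H : Subgroup Γ} (h0 : ∀ h ∈ H, c h = 0)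
    {g g' : Γ} (hgg' : (QuotientGroup.mk g : Γ ⧸ H) = QuotientGroup.mk g') : c g = c g' := by
  have hmem : g⁻¹ * g' ∈ H := QuotientGroup.eq.1 hgg'
  have h := apply_mul_eq_of_forall_mem 𝔅 ρ hc h0 g hmem
  rw [mul_inv_cancel_left] at h
  exact h.symm

/-! ## §2 Descent along a subgroup of finite index -/

/-- **`Fil⁰`-coboundaries descend along subgroups of finite index** (`char E = 0`). Let `c : Γ → B ⊗ V` be a `1`-cocycle with
values in `Fil⁰(B ⊗ V)` whose restriction to a finite-index subgroup `H` is a `Fil⁰`-coboundary. Then `c` is a `Fil⁰`-coboundary: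
`c − ∂b` vanishes on `H`, its coset average `y` satisfies `σ·y = y − [Γ:H](c − ∂b)(σ)`, and `[Γ:H]` is invertible in `E`.
[cite: NeukirchSchmidtWingberg2008, Cor. (1.5.7) and Prop. (1.6.11)] [cite: Kato1993LNM1553, Ch. II §1.2.4] -/
theorem IsFilZeroCoboundary.of_subgroup [CharZero E] (H : Subgroup Γ) [H.FiniteIndex] {c : Γ → 𝔅.B ⊗[P] M}
    (hc : ∀ σ τ, c (σ * τ) = c σ + 𝔅.tensorRep ρ σ (c τ)) (hfil : ∀ σ, c σ ∈ 𝔅.filTensor M 0)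
    (hH : ∃ b ∈ 𝔅.filTensor M 0, ∀ h ∈ H, c h = 𝔅.tensorRep ρ h b - b) :
    𝔅.IsFilZeroCoboundary ρ c := by
  classical
  obtain ⟨b, hb, hbH⟩ := hH
  letI : Fintype (Γ ⧸ H) := Fintype.ofFinite (Γ ⧸ H)
  -- `c' = c − ∂b`: a cocycle with values in `Fil⁰`, vanishing on `H`
  obtain ⟨c', hc'def⟩ : ∃ c' : Γ → 𝔅.B ⊗[P] M, ∀ σ, c' σ = c σ - (𝔅.tensorRep ρ σ b - b) := ⟨_, fun _ => rfl⟩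
  have hc' : ∀ σ τ, c' (σ * τ) = c' σ + 𝔅.tensorRep ρ σ (c' τ) := fun σ τ => by
    rw [hc'def, hc'def, hc'def]
    exact sub_coboundary_cocycle 𝔅 ρ hc b σ τ
  have hc'fil : ∀ σ, c' σ ∈ 𝔅.filTensor M 0 := fun σ => by
    rw [hc'def]
    exact Submodule.sub_mem _ (hfil σ) (Submodule.sub_mem _ (PAdicHodge.TateGraded.tensorRep_mem_filTensor 𝔅 ρ σ hb) hb)
  have hc'H : ∀ h ∈ H, c' h = 0 := fun h hh => by
    rw [hc'def, hbH h hh, sub_self]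
  -- the coset average
  obtain ⟨y, hydef⟩ : ∃ y : 𝔅.B ⊗[P] M, y = ∑ q : Γ ⧸ H, c' q.out := ⟨_, rfl⟩
  have hyfil : y ∈ 𝔅.filTensor M 0 := by
    rw [hydef]
    exact Submodule.sum_mem _ fun q _ => hc'fil _
  -- `c'` on representatives: `c'((σ • q).out) = c'(σ * q.out)`
  have hrep : ∀ (σ : Γ) (q : Γ ⧸ H), c' (σ • q).out = c' (σ * q.out) := fun σ q => by
    refine apply_eq_of_mk_eq 𝔅 ρ hc' hc'H ?_
    rw [QuotientGroup.out_eq', ← smul_eq_mul, ← MulAction.Quotient.smul_mk, QuotientGroup.out_eq']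
  -- `σ·y = y − m·c'(σ)`
  have hσy : ∀ σ : Γ, 𝔅.tensorRep ρ σ y = y - (H.index : E) • c' σ := fun σ => by
    rw [hydef, map_sum]
    have h1 : ∀ q : Γ ⧸ H, 𝔅.tensorRep ρ σ (c' q.out) = c' (σ • q).out - c' σ := fun q => by
      rw [tensorRep_apply_eq_sub 𝔅 ρ hc', hrep]
    simp_rw [h1]
    rw [Finset.sum_sub_distrib, Finset.sum_const, Finset.card_univ, ← Nat.cast_smul_eq_nsmul E,
      Subgroup.index_eq_card, Nat.card_eq_fintype_card]
    congr 1
    exact Equiv.sum_comp (MulAction.toPerm σ) (fun q : Γ ⧸ H => c' q.out)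
  -- conclusion: `c = ∂(b − y/m)`
  have hm : (H.index : E) ≠ 0 := Nat.cast_ne_zero.2 Subgroup.FiniteIndex.index_ne_zero
  refine ⟨b - (H.index : E)⁻¹ • y, Submodule.sub_mem _ hb (Submodule.smul_mem _ _ hyfil), fun σ => ?_⟩
  have h2 : c σ = c' σ + (𝔅.tensorRep ρ σ b - b) := by rw [hc'def, sub_add_cancel]
  rw [map_sub, map_smul, hσy σ, smul_sub, smul_smul, inv_mul_cancel₀ hm, one_smul, h2]
  abel

/-- **Descent along a group homomorphism with finite-index range** (`ι : Γ' →* Γ`, e.g. the restriction `Γ_{F'} → Γ_F` of a finite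
extension `F'/F`): if `c ∘ ι` is a `Fil⁰`-coboundary for an element of `Fil⁰`, then the `Fil⁰`-valued cocycle `c` is a `Fil⁰`-coboundary
on `Γ`. [cite: NeukirchSchmidtWingberg2008, Cor. (1.5.7)] [cite: Kato1993LNM1553, Ch. II §1.2.4] -/
theorem IsFilZeroCoboundary.of_range [CharZero E] {Γ' : Type*} [Group Γ'] (ι : Γ' →* Γ) [ι.range.FiniteIndex]
    {c : Γ → 𝔅.B ⊗[P] M} (hc : ∀ σ τ, c (σ * τ) = c σ + 𝔅.tensorRep ρ σ (c τ)) (hfil : ∀ σ, c σ ∈ 𝔅.filTensor M 0)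
    (hH : ∃ b ∈ 𝔅.filTensor M 0, ∀ h : Γ', c (ι h) = 𝔅.tensorRep ρ (ι h) b - b) :
    𝔅.IsFilZeroCoboundary ρ c := by
  obtain ⟨b, hb, hbH⟩ := hH
  refine IsFilZeroCoboundary.of_subgroup 𝔅 ρ ι.range hc hfil ⟨b, hb, ?_⟩
  rintro _ ⟨h, rfl⟩
  exact hbH h

/-- **Restriction** (the converse, trivial direction): a `Fil⁰`-coboundary on `Γ` restricts to a `Fil⁰`-coboundary along any
`ι : Γ' →* Γ`, with the same integrating element. [cite: Kato1993LNM1553, Ch. II §1.2.4] -/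
theorem IsFilZeroCoboundary.exists_of_comp {Γ' : Type*} [Group Γ'] (ι : Γ' →* Γ) {c : Γ → 𝔅.B ⊗[P] M}
    (h : 𝔅.IsFilZeroCoboundary ρ c) :
    ∃ b ∈ 𝔅.filTensor M 0, ∀ h : Γ', c (ι h) = 𝔅.tensorRep ρ (ι h) b - b := by
  obtain ⟨b, hb, hbc⟩ := h
  exact ⟨b, hb, fun h => hbc (ι h)⟩

/-- **The lattice cocycles of K1 are `Fil⁰`-valued `1`-cocycles**: for a crossed homomorphism `η : Γ → V` of `ρ`
(`η(στ) = η(σ) + ρ(σ)η(τ)`), `σ ↦ 1 ⊗ η(σ)` is a `1`-cocycle of `B ⊗ V` with values in `Fil⁰(B ⊗ V)` — the hypotheses `hc`, `hfil` of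
`IsFilZeroCoboundary.of_subgroup`. [cite: Kato1993LNM1553, Ch. II §1.2.4] -/
theorem one_tmul_cocycle {η : Γ → M} (hη : ∀ σ τ, η (σ * τ) = η σ + ρ σ (η τ)) (σ τ : Γ) :
    ((1 : 𝔅.B) ⊗ₜ[P] η (σ * τ) : 𝔅.B ⊗[P] M) =
      (1 : 𝔅.B) ⊗ₜ[P] η σ + 𝔅.tensorRep ρ σ ((1 : 𝔅.B) ⊗ₜ[P] η τ) := by
  rw [hη, TensorProduct.tmul_add, tensorRep_apply_tmul, smul_one]

/-- ★ **K1-shaped descent**: for a crossed homomorphism `η : Γ → V` of `ρ` and a finite-index subgroup `H ≤ Γ`, if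
`σ ↦ 1 ⊗ η(σ)` is a `Fil⁰`-coboundary on `H` then it is a `Fil⁰`-coboundary on `Γ`. [cite: NeukirchSchmidtWingberg2008, Cor. (1.5.7)]
[cite: BlochKato1990, Lemma 3.8.1] -/
theorem isFilZeroCoboundary_one_tmul_of_subgroup [CharZero E] (H : Subgroup Γ) [H.FiniteIndex] {η : Γ → M}
    (hη : ∀ σ τ, η (σ * τ) = η σ + ρ σ (η τ))
    (hH : ∃ b ∈ 𝔅.filTensor M 0, ∀ h ∈ H, ((1 : 𝔅.B) ⊗ₜ[P] η h : 𝔅.B ⊗[P] M) = 𝔅.tensorRep ρ h b - b) :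
    𝔅.IsFilZeroCoboundary ρ fun σ => (1 : 𝔅.B) ⊗ₜ[P] η σ :=
  IsFilZeroCoboundary.of_subgroup 𝔅 ρ H (fun σ τ => one_tmul_cocycle 𝔅 ρ hη σ τ)
    (fun σ => one_tmul_mem_filTensor_zero (η σ)) hH

end Descent

end Literature.NumberTheory.GaloisRepresentations.PeriodRingData

end
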